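import Summits.NavierStokesRegularity.NavierStokesRegularity.Theorems.OddMorawetzMorawetzKillsTypeISignedPermBasis
import Summits.NavierStokesRegularity.NavierStokesRegularity.Theorems.OddMorawetzMorawetzKillsTypeICubicJetExpansion
import Summits.NavierStokesRegularity.NavierStokesRegularity.Theorems.OddMorawetzMorawetzKillsTypeIJetCoordDefs

/-!
# Route OddMorawetz — `MorawetzKillsTypeI`, the symmetrised basis of multilinear maps
(item stmt-NavierStokesRegularity-1377, line `registered`, stub `stub_symBasis`)

The jets of smooth vector fields are SYMMETRIC multilinear maps `ℝ³ × ⋯ × ℝ³ → ℝ³`, so the isotropy cut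
of the crux expands them in the (un-normalised) symmetrised basis
`S n c J = jbsum n c J = ∑_{π ∈ 𝔖ₙ} jbasis n c (J ∘ π)`, `jbasis n c J : h ↦ (∏ₛ h_s (J s)) • e_c`
(`Theorems/OddMorawetzMorawetzKillsTypeIJetCoordDefs`). Four elementary facts (Mathlib + the landed
`CubicJetExpansion.coordinate_expansion` and `mlAct_signedPerm_basis`):

* (L1) `jbsum n c (J ∘ σ) = jbsum n c J` (reindex the sum over `π` by left multiplication with `σ`);
* (L2) a symmetric `Z` expands as `Z = ∑_c ∑_J ((Z (e ∘ J))_c / n!) • jbsum n c J` (average the coordinate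
  expansion over `𝔖ₙ`, using `Z (e ∘ J ∘ π) = Z (e ∘ J)`);
* (L3) the hyperoctahedral group acts by `mlAct (signedPerm σ ε) n (jbsum n c J) = (ε(σ c) ∏ₛ ε(σ (J s))) •
  jbsum n (σ c) (σ ∘ J)` (termwise `mlAct_signedPerm_basis`, the sign is reordering invariant);
* (L4) every linear `L : ℝ³ → ℝ³` acts as a derivation by the matrix formula
  `L ∘ S − ∑ₛ S ∘ₛ L = ∑_{c'} L_{c' c} S n c' J − ∑ₛ ∑_{j'} L_{J s, j'} S n c (J[s ↦ j'])`
  (coordinates on `jbasis`, then `update (J ∘ π) s j' = update J (π s) j' ∘ π` and a reindexing `s ↦ π s`).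
-/

noncomputable section

set_option linter.dupNamespace false

namespace Summit.NavierStokesRegularity.NavierStokesRegularity.Theorems

open Summit.NavierStokesRegularity.NavierStokesRegularity.Theorems.OddMorawetz

namespace SymBasis

/-! ### (L1) reordering invariance -/

/-- (L1) The symmetrised basis map does not see a reordering of its index map. -/
theorem jbsum_comp_perm (n : ℕ) (c : Fin 3) (J : Fin n → Fin 3) (σ : Equiv.Perm (Fin n)) :
    jbsum n c (J ∘ σ) = jbsum n c J := by
  rw [jbsum_def, jbsum_def]
  exact Fintype.sum_equiv (Equiv.mulLeft σ) _ _ fun π => rfl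

/-! ### (L2) expansion of symmetric multilinear maps -/

/-- Reindexing a sum over index maps `J : Fin n → Fin 3` by precomposition with a permutation of `Fin n`. -/
theorem sum_index_comp_perm {M : Type*} [AddCommMonoid M] (n : ℕ) (π : Equiv.Perm (Fin n))
    (g : (Fin n → Fin 3) → M) : ∑ J : Fin n → Fin 3, g (J ∘ π) = ∑ J : Fin n → Fin 3, g J :=
  Fintype.sum_equiv (Equiv.arrowCongr π.symm (Equiv.refl (Fin 3))) _ _ fun _ => rfl

/-- (L2) A symmetric continuous `n`-multilinear map `Z : ℝ³ × ⋯ × ℝ³ → ℝ³` expands in the symmetrised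
basis with coefficients `(Z (e ∘ J))_c / n!`. -/
theorem symm_expansion (n : ℕ) (Z : E3 [×n]→L[ℝ] E3)
    (hZ : ∀ (h : Fin n → E3) (σ : Equiv.Perm (Fin n)), Z (h ∘ σ) = Z h) :
    Z = ∑ c : Fin 3, ∑ J : Fin n → Fin 3,
      ((Z (fun s => EuclideanSpace.single (J s) (1 : ℝ)) c) / (n.factorial : ℝ)) • jbsum n c J := by
  obtain ⟨a, ha⟩ : ∃ a : Fin 3 → (Fin n → Fin 3) → ℝ,
      ∀ c J, a c J = Z (fun s => EuclideanSpace.single (J s) (1 : ℝ)) c := ⟨_, fun _ _ => rfl⟩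
  have hexp : Z = ∑ c, ∑ J, a c J • jbasis n c J := by
    simp only [ha]
    exact CubicJetExpansion.coordinate_expansion n Z
  have hsymm : ∀ (c : Fin 3) (J : Fin n → Fin 3) (π : Equiv.Perm (Fin n)), a c (J ∘ π) = a c J := by
    intro c J π
    rw [ha, ha]
    exact congrArg (fun v : E3 => v c) (hZ (fun s => EuclideanSpace.single (J s) (1 : ℝ)) π)
  have key : ∀ π : Equiv.Perm (Fin n), Z = ∑ c, ∑ J, a c J • jbasis n c (J ∘ π) := by
    intro π
    rw [hexp]
    refine Finset.sum_congr rfl fun c _ => ?_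
    rw [← sum_index_comp_perm n π (fun J => a c J • jbasis n c J)]
    simp only [hsymm]
  have hsum : (n.factorial : ℝ) • Z = ∑ c, ∑ J, a c J • jbsum n c J := by
    calc (n.factorial : ℝ) • Z = ∑ _π : Equiv.Perm (Fin n), Z := by
          rw [Finset.sum_const, Finset.card_univ, Fintype.card_perm, Fintype.card_fin, ← Nat.cast_smul_eq_nsmul ℝ]
      _ = ∑ π : Equiv.Perm (Fin n), ∑ c, ∑ J, a c J • jbasis n c (J ∘ π) :=
          Finset.sum_congr rfl fun π _ => key π
      _ = ∑ c, ∑ J, a c J • jbsum n c J := by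
          rw [Finset.sum_comm]
          refine Finset.sum_congr rfl fun c _ => ?_
          rw [Finset.sum_comm]
          refine Finset.sum_congr rfl fun J _ => ?_
          rw [jbsum_def, Finset.smul_sum]
  calc Z = (n.factorial : ℝ)⁻¹ • ((n.factorial : ℝ) • Z) := by
        rw [smul_smul, inv_mul_cancel₀ (Nat.cast_ne_zero.2 (Nat.factorial_ne_zero n)), one_smul]
    _ = _ := by
        rw [hsum, Finset.smul_sum]
        refine Finset.sum_congr rfl fun c _ => ?_
        rw [Finset.smul_sum]
        refine Finset.sum_congr rfl fun J _ => ?_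
        rw [smul_smul, div_eq_inv_mul, ha]

/-! ### (L3) the hyperoctahedral group -/

/-- `mlAct_signedPerm_basis` in the `jbasis` spelling. -/
theorem mlAct_jbasis (σ : Equiv.Perm (Fin 3)) (ε : Fin 3 → ℤˣ) (n : ℕ) (c : Fin 3) (J : Fin n → Fin 3) :
    mlAct (signedPerm σ ε) n (jbasis n c J) =
      (((ε (σ c) : ℤ) : ℝ) * ∏ s, ((ε (σ (J s)) : ℤ) : ℝ)) • jbasis n (σ c) (σ ∘ J) :=
  mlAct_signedPerm_basis σ ε n c J

/-- (L3) A signed coordinate permutation `(σ, ε)` maps `jbsum n c J` to `± jbsum n (σ c) (σ ∘ J)` with the sign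
`ε(σ c) ∏ₛ ε(σ (J s))`. -/
theorem mlAct_jbsum (σ : Equiv.Perm (Fin 3)) (ε : Fin 3 → ℤˣ) (n : ℕ) (c : Fin 3) (J : Fin n → Fin 3) :
    mlAct (signedPerm σ ε) n (jbsum n c J) =
      (((ε (σ c) : ℤ) : ℝ) * ∏ s, ((ε (σ (J s)) : ℤ) : ℝ)) • jbsum n (σ c) (σ ∘ J) := by
  rw [jbsum_def, jbsum_def, map_sum, Finset.smul_sum]
  refine Finset.sum_congr rfl fun π _ => ?_
  rw [mlAct_jbasis]
  simp only [Function.comp_def]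
  rw [Equiv.prod_comp π (fun s => (((ε (σ (J s))) : ℤ) : ℝ))]

/-! ### (L4) linear maps act as derivations: the matrix formula -/

/-- Coordinates: `x = ∑ⱼ xⱼ eⱼ` in `ℝ³`. -/
theorem eq_sum_single (x : E3) : x = ∑ j : Fin 3, x j • EuclideanSpace.single j (1 : ℝ) := by
  conv_lhs => rw [← (EuclideanSpace.basisFun (Fin 3) ℝ).sum_repr x]
  simp

/-- Coordinates of `L x`: `(L x)_i = ∑ⱼ xⱼ (L eⱼ)_i`. -/
theorem apply_coord (L : E3 →L[ℝ] E3) (x : E3) (i : Fin 3) :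
    L x i = ∑ j : Fin 3, x j * L (EuclideanSpace.single j (1 : ℝ)) i := by
  conv_lhs => rw [eq_sum_single x]
  simp [map_sum, map_smul, WithLp.ofLp_sum, Finset.sum_apply]

/-- Splitting off the updated factor: `∏ₜ (U t (h t))_{J t}` for `U = id` except `U s = L`. -/
theorem prod_update_map (n : ℕ) (s : Fin n) (L : E3 →L[ℝ] E3) (h : Fin n → E3) (J : Fin n → Fin 3) :
    ∏ t, (Function.update (fun _ => ContinuousLinearMap.id ℝ E3) s L t) (h t) (J t) =
      L (h s) (J s) * ∏ t ∈ Finset.univ.erase s, h t (J t) := by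
  rw [← Finset.mul_prod_erase Finset.univ _ (Finset.mem_univ s), Function.update_self]
  congr 1
  refine Finset.prod_congr rfl fun t ht => ?_
  rw [Function.update_of_ne (Finset.ne_of_mem_erase ht)]
  rfl

/-- Splitting off the updated factor: `∏ₜ (h t)_{J[s ↦ j'] t}`. -/
theorem prod_update_index (n : ℕ) (s : Fin n) (j' : Fin 3) (h : Fin n → E3) (J : Fin n → Fin 3) :
    ∏ t, h t (Function.update J s j' t) = h s j' * ∏ t ∈ Finset.univ.erase s, h t (J t) := by
  rw [← Finset.mul_prod_erase Finset.univ _ (Finset.mem_univ s), Function.update_self]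
  congr 1
  refine Finset.prod_congr rfl fun t ht => ?_
  rw [Function.update_of_ne (Finset.ne_of_mem_erase ht)]

/-- (L4), outer part on the basis: `L ∘ jbasis n c J = ∑_{c'} (L e_c)_{c'} • jbasis n c' J`. -/
theorem comp_jbasis (L : E3 →L[ℝ] E3) (n : ℕ) (c : Fin 3) (J : Fin n → Fin 3) :
    L.compContinuousMultilinearMap (jbasis n c J) =
      ∑ c' : Fin 3, (L (EuclideanSpace.single c (1 : ℝ)) c') • jbasis n c' J := by
  ext h l
  simp only [ContinuousLinearMap.compContinuousMultilinearMap_coe, Function.comp_apply, jbasis_apply, map_smul,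
    sum_apply, smul_apply, PiLp.smul_apply, smul_eq_mul,
    WithLp.ofLp_sum, Finset.sum_apply, PiLp.single_apply, mul_ite, mul_one, mul_zero, Finset.sum_ite_eq,
    Finset.mem_univ, if_true]
  ring

/-- (L4), inner part on the basis: `jbasis n c J ∘ₛ L = ∑_{j'} (L e_{j'})_{J s} • jbasis n c (J[s ↦ j'])`. -/
theorem jbasis_comp_update (L : E3 →L[ℝ] E3) (n : ℕ) (c : Fin 3) (J : Fin n → Fin 3) (s : Fin n) :
    (jbasis n c J).compContinuousLinearMap (Function.update (fun _ => ContinuousLinearMap.id ℝ E3) s L) =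
      ∑ j' : Fin 3, (L (EuclideanSpace.single j' (1 : ℝ)) (J s)) • jbasis n c (Function.update J s j') := by
  ext h l
  simp only [ContinuousMultilinearMap.compContinuousLinearMap_apply, jbasis_apply, prod_update_map,
    sum_apply, smul_apply, prod_update_index,
    PiLp.smul_apply, smul_eq_mul, WithLp.ofLp_sum, Finset.sum_apply]
  rw [apply_coord L (h s) (J s), Finset.sum_mul, Finset.sum_mul]
  refine Finset.sum_congr rfl fun j' _ => ?_
  ring

/-- (L4), outer part: `L ∘ jbsum n c J = ∑_{c'} (L e_c)_{c'} • jbsum n c' J`. -/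
theorem comp_jbsum (L : E3 →L[ℝ] E3) (n : ℕ) (c : Fin 3) (J : Fin n → Fin 3) :
    L.compContinuousMultilinearMap (jbsum n c J) =
      ∑ c' : Fin 3, (L (EuclideanSpace.single c (1 : ℝ)) c') • jbsum n c' J := by
  have h1 : L.compContinuousMultilinearMap (jbsum n c J) =
      ∑ π : Equiv.Perm (Fin n), L.compContinuousMultilinearMap (jbasis n c (J ∘ π)) := by
    ext1 h
    simp [jbsum_def, map_sum]
  rw [h1]
  simp only [comp_jbasis]
  rw [Finset.sum_comm]
  simp only [jbsum_def, Finset.smul_sum]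

/-- (L4), inner part: `∑ₛ jbsum n c J ∘ₛ L = ∑ₛ ∑_{j'} (L e_{j'})_{J s} • jbsum n c (J[s ↦ j'])`. -/
theorem sum_jbsum_comp_update (L : E3 →L[ℝ] E3) (n : ℕ) (c : Fin 3) (J : Fin n → Fin 3) :
    ∑ s : Fin n, (jbsum n c J).compContinuousLinearMap
        (Function.update (fun _ => ContinuousLinearMap.id ℝ E3) s L) =
      ∑ s : Fin n, ∑ j' : Fin 3,
        (L (EuclideanSpace.single j' (1 : ℝ)) (J s)) • jbsum n c (Function.update J s j') := by
  -- the summands `G π s j'` of the triple sums (after the reindexing `s ↦ π s` on the left)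
  obtain ⟨G, hG⟩ : ∃ G : Equiv.Perm (Fin n) → Fin n → Fin 3 → (E3 [×n]→L[ℝ] E3), ∀ π s j',
      G π s j' = (L (EuclideanSpace.single j' (1 : ℝ)) (J s)) • jbasis n c (Function.update J s j' ∘ π) :=
    ⟨_, fun _ _ _ => rfl⟩
  have h1 : ∀ s : Fin n,
      (jbsum n c J).compContinuousLinearMap (Function.update (fun _ => ContinuousLinearMap.id ℝ E3) s L) =
        ∑ π : Equiv.Perm (Fin n), ∑ j' : Fin 3, G π (π s) j' := by
    intro s
    have h2 : (jbsum n c J).compContinuousLinearMap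
        (Function.update (fun _ => ContinuousLinearMap.id ℝ E3) s L) =
        ∑ π : Equiv.Perm (Fin n), (jbasis n c (J ∘ π)).compContinuousLinearMap
          (Function.update (fun _ => ContinuousLinearMap.id ℝ E3) s L) := by
      ext1 h
      simp [jbsum_def]
    rw [h2]
    refine Finset.sum_congr rfl fun π _ => ?_
    rw [jbasis_comp_update]
    refine Finset.sum_congr rfl fun j' _ => ?_
    rw [hG, Function.update_comp_eq_of_injective J π.injective s j']
    rfl
  have h3 : ∀ π : Equiv.Perm (Fin n),
      ∑ s : Fin n, ∑ j' : Fin 3, G π (π s) j' = ∑ s : Fin n, ∑ j' : Fin 3, G π s j' :=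
    fun π => Equiv.sum_comp π (fun s => ∑ j' : Fin 3, G π s j')
  calc ∑ s : Fin n, (jbsum n c J).compContinuousLinearMap
          (Function.update (fun _ => ContinuousLinearMap.id ℝ E3) s L)
      = ∑ s : Fin n, ∑ π : Equiv.Perm (Fin n), ∑ j' : Fin 3, G π (π s) j' :=
        Finset.sum_congr rfl fun s _ => h1 s
    _ = ∑ π : Equiv.Perm (Fin n), ∑ s : Fin n, ∑ j' : Fin 3, G π (π s) j' := Finset.sum_comm
    _ = ∑ π : Equiv.Perm (Fin n), ∑ s : Fin n, ∑ j' : Fin 3, G π s j' :=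
        Finset.sum_congr rfl fun π _ => h3 π
    _ = ∑ s : Fin n, ∑ π : Equiv.Perm (Fin n), ∑ j' : Fin 3, G π s j' := Finset.sum_comm
    _ = ∑ s : Fin n, ∑ j' : Fin 3, ∑ π : Equiv.Perm (Fin n), G π s j' :=
        Finset.sum_congr rfl fun s _ => Finset.sum_comm
    _ = ∑ s : Fin n, ∑ j' : Fin 3,
          (L (EuclideanSpace.single j' (1 : ℝ)) (J s)) • jbsum n c (Function.update J s j') := by
        simp only [hG, jbsum_def, Finset.smul_sum]

/-- (L4) The matrix formula for the derivation action `L ∘ S − ∑ₛ S ∘ₛ L` of a linear map on `jbsum`. -/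
theorem derivation_jbsum (L : E3 →L[ℝ] E3) (n : ℕ) (c : Fin 3) (J : Fin n → Fin 3) :
    L.compContinuousMultilinearMap (jbsum n c J) -
        ∑ s : Fin n, (jbsum n c J).compContinuousLinearMap
          (Function.update (fun _ => ContinuousLinearMap.id ℝ E3) s L) =
      ∑ c' : Fin 3, (L (EuclideanSpace.single c (1 : ℝ)) c') • jbsum n c' J -
        ∑ s : Fin n, ∑ j' : Fin 3,
          (L (EuclideanSpace.single j' (1 : ℝ)) (J s)) • jbsum n c (Function.update J s j') := by
  rw [comp_jbsum, sum_jbsum_comp_update]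

end SymBasis

/-! ### The registered statement -/

/-- **stub `stub_symBasis` of the crux `OddMorawetz.MorawetzKillsTypeI` (line `registered`). Symmetrised basis
maps.** With `B n c J : h ↦ (∏ₛ h_s (J s)) e_c` the basis `n`-multilinear maps and `S n c J = ∑_{π ∈ 𝔖ₙ} B n c (J ∘ π)`
their un-normalised symmetrisations: (L1) `S` is reordering invariant; (L2) a SYMMETRIC `n`-multilinear map expands
as `Z = ∑_c ∑_J ((Z (e ∘ J))_c / n!) • S n c J`; (L3) the hyperoctahedral group acts on `S n c J` by a sign and the
index permutation; (L4) every linear `L : ℝ³ → ℝ³` acts on `S n c J` as a derivation (`L ∘ Z − ∑ₛ Z ∘ₛ L`) by the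
explicit matrix formula. -/
theorem stub_symBasis :
    let e : Fin 3 → E3 := fun i => EuclideanSpace.single i (1 : ℝ);
    let B := fun (n : ℕ) (c : Fin 3) (J : Fin n → Fin 3) =>
      (ContinuousMultilinearMap.mkPiRing ℝ (Fin n) (e c)).compContinuousLinearMap
        (fun s => (EuclideanSpace.proj (J s) : E3 →L[ℝ] ℝ));
    let S := fun (n : ℕ) (c : Fin 3) (J : Fin n → Fin 3) => ∑ π : Equiv.Perm (Fin n), B n c (J ∘ π);
    (∀ (n : ℕ) (c : Fin 3) (J : Fin n → Fin 3) (σ : Equiv.Perm (Fin n)), S n c (J ∘ σ) = S n c J) ∧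
    (∀ (n : ℕ) (Z : E3 [×n]→L[ℝ] E3), (∀ (h : Fin n → E3) (σ : Equiv.Perm (Fin n)), Z (h ∘ σ) = Z h) →
      Z = ∑ c : Fin 3, ∑ J : Fin n → Fin 3, ((Z (fun s => e (J s)) c) / (n.factorial : ℝ)) • S n c J) ∧
    (∀ (σ : Equiv.Perm (Fin 3)) (ε : Fin 3 → ℤˣ) (n : ℕ) (c : Fin 3) (J : Fin n → Fin 3),
      mlAct (signedPerm σ ε) n (S n c J) =
        (((ε (σ c) : ℤ) : ℝ) * ∏ s, ((ε (σ (J s)) : ℤ) : ℝ)) • S n (σ c) (σ ∘ J)) ∧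
    (∀ (L : E3 →L[ℝ] E3) (n : ℕ) (c : Fin 3) (J : Fin n → Fin 3),
      L.compContinuousMultilinearMap (S n c J) -
          ∑ s : Fin n, (S n c J).compContinuousLinearMap (Function.update (fun _ => ContinuousLinearMap.id ℝ E3) s L) =
        ∑ c' : Fin 3, (L (e c) c') • S n c' J -
          ∑ s : Fin n, ∑ j' : Fin 3, (L (e j') (J s)) • S n c (Function.update J s j')) := by
  intro e B S
  exact ⟨fun n c J σ => SymBasis.jbsum_comp_perm n c J σ, fun n Z hZ => SymBasis.symm_expansion n Z hZ,
    fun σ ε n c J => SymBasis.mlAct_jbsum σ ε n c J, fun L n c J => SymBasis.derivation_jbsum L n c J⟩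

end Summit.NavierStokesRegularity.NavierStokesRegularity.Theorems
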